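import Mathlib
import Literature.MathematicalPhysics.QuantumFieldTheory.Balaban1983to89.B1
import Literature.MathematicalPhysics.QuantumFieldTheory.Balaban1983to89.B2
import Literature.MathematicalPhysics.QuantumFieldTheory.Balaban1983to89.B4Prop31Zero

/-!
# `Balaban1983to89.B2Prop31ZeroField` — T. Bałaban, *(Higgs)₂,₃ quantum fields in a finite volume. II. An upper bound*,
Commun. Math. Phys. **86** (1982) 555–594 [Balaban1982Higgs2], **Proposition 3.1** p. 589, ITS ZERO-FIELD CLAUSE
*"If Ã^ε = 0, then the inequality holds without the last sum on the right side and without any restrictions on the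
configuration Φ"*, and the per-scale unit-lattice inequality **(3.29)** p. 590 AT `Ã^η = 0` — PROVED on concrete
carriers: (3.29)₀ for EVERY scale `k ≥ 1` (mesh `L^{-k}`, coefficient `a_k` of I (2.15)), EVERY finite `Λ_k ⊂ ℤ^d`, EVERY
`L^kε ∈ (0, 1]` and EVERY `φ′_k`, with ONE explicit constant `γ₀ = min(a(1 − L⁻²)/(8d + 2m²), 1/8)` and NO error term
(the cell's verbatim-typed `B2.Ineq329Printed κ₀` INHABITED, `C = 0`), from the b04 lineage's (1.22)-at-`A = 0`
`B4Prop31Zero.KeffR_form_ge` ([Balaban1983RegularityDecay] p. 574: *"This theorem implies (3.29) of [2]"*); and (3.26)₀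
with that γ₀ by the printed reduction (3.27)–(3.28) (the cell's `B2.prop31_of_decoupling`), the inputs (3.27)/(3.28)
carried as the defining data of the multiscale family (the cell's verbatim-typed `B2.Prop31Printed P` INHABITED for it)

statement-level skeleton of published theorems with citation tags; proofs where landed; nothing here is a claim about the Yang–Mills mass gap

PDF held: `paper:balaban1982-cmp86-higgs23-ii` (journal page = PDF page + 554); pp. 588–590 READ AS IMAGES on the ×2
renders `run/shared/lean/pub/pub-balaban/b2b-balaban-ref1/pages/1982-cmp86-higgs23-II/1982-cmp86-higgs23-II-p034-x2.png` …
`-p036-x2.png`.  Unit `lit-balaban-r14` gen 5 (reader/typer of B1–B2, SECOND READER of B2; B2 fold owner r02, §3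
verifier r13), HOME `run/shared/lean/pub/lit-balaban/`.  SKELETON rows **B2.Prop3.1** (Prop. 3.1 (3.26) p. 589; decl of
record `B2.Prop31Printed`, cell pub-balaban unit pv07, `typed-existing`) and **B2.Eq3.29** ((3.27)–(3.29) pp. 589–590;
of record `B2.Ineq329Printed` / `B2.Ineq329Upto` + the reduction `B2.prop31_of_decoupling`, `B2.rescale_bond` /
`B2.rescale_mass`; member (3.27) PROVED by p15 `B2Sect3BSchurStep.ineq327`).

THE SOURCE TEXT (verbatim).  p. 589 [PDF 35]: *"**Proposition 3.1.** There exists a constant γ₀ > 0 dependent on the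
space dimension d and the constant a only, and independent of ε and a choice of the sets Λ₅⁽⁰⁾, …, Λ₅⁽ᴷ⁻¹⁾, such that
for arbitrary configurations Ã^ε, Φ defined by the formulas (3.2), (3.3), (3.24), and satisfying the restrictions given
by the characteristic functions in (3.21), the following inequality holds
⟨Φ, Δ(Ã^ε)Φ⟩ ≧ γ₀ Σ_{k=0}^{K} Σ_{⟨x,x′⟩⊂Λ₅⁽ᵏ⁻¹⁾′∩Λ₅⁽ᵏ⁾ᶜ} (Lᵏε)^{d−2}|U(Ã^ε(⟨x,x′⟩))φ_k(x′) − φ_k(x)|²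
 + γ₀ Σ_{k=0}^{K} Σ_{x∈Λ₅⁽ᵏ⁻¹⁾′∩Λ₅⁽ᵏ⁾ᶜ} (Lᵏε)^d m²|φ_k(x)|² − Σ_{k=1}^{K} O((Lᵏε)^{κ₀})|(Λ₅⁽ᵏ⁻¹⁾′∩Λ₅⁽ᵏ⁾ᶜ)₁|,  (3.26)
with κ₀ > 0. The last symbol in the above inequality denotes the measure of a set rescaled to the unit lattice, i.e. the
number of points in the set. We assume m² ≦ O(1) also. If Ã^ε = 0, then the inequality holds without the last sum on the
right side and without any restrictions on the configuration Φ."*  p. 589–590 (proof): *"… ⟨Φ, Δ(Ã^ε)Φ⟩ ≧ ⟨Φ, Δ′(Ã^ε)Φ⟩,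
(3.27) because the inequality for the integrals holds for all Φ. … The form ⟨Φ, Δ′(Ã^ε)Φ⟩ is given by the formula
⟨Φ, Δ′(Ã^ε)Φ⟩ = Σ_{k=0}^{K} ⟨φ_k, Δ^{(k),Lᵏε}(Bᵏ(Λ₅⁽ᵏ⁻¹⁾′∩Λ₅⁽ᵏ⁾ᶜ), Ã^ε)φ_k⟩. (3.28)  The term for k = 0 already has the
form required by the right side of (3.26), so we need the inequalities for the remaining terms. Let us rescale the kᵗʰ
term from the Lᵏε-lattice to the 1-lattice, φ_k(x) = (Lᵏε)^{−(d−2)/2}φ′_k((Lᵏε)⁻¹x), and let us denote for simplicity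
Λ_k = (Λ₅⁽ᵏ⁻¹⁾′∩Λ₅⁽ᵏ⁾ᶜ)₁. Now inequality (3.26) of the proposition follows from
⟨φ′_k, Δ⁽ᵏ⁾(Bᵏ(Λ_k), Ã^η)φ′_k⟩ ≧ γ₀(Σ_{⟨x,x′⟩⊂Λ_k}|U(Ã^η(⟨x,x′⟩))φ′_k(x′) − φ′_k(x)|² + Σ_{x∈Λ_k} m²(Lᵏε)²|φ′_k(x)|²)
 − O((Lᵏε)^{κ₀})|Λ_k|,  (3.29)  with a constant γ₀ independent of k, Λ_k and for φ′_k, Ã^η satisfying suitable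
restrictions. This inequality will be proved together with the properties of the covariances (formulated in
Propositions I.2.1 and I.2.3)."*  [Balaban1983RegularityDecay] ("B4") p. 574 [PDF 4], after its «Proposition 3.1′ of
[2]» (1.21)–(1.22): *"This theorem implies (3.29) of [2]."*  Part I [Balaban1982Higgs1] (2.15) p. 609: `a_k ↘ a_∞ =
a(1 − L^{−2})` (`B1.aSeq`, `B1.ainf_lt_aSeq`).

DICTIONARY (the b04 lineage's lattice units, `B4Prop31Zero` DICTIONARY; `A = 0`, so `U ≡ 1` and every operator acts
componentwise on `φ : Λ_k → ℝ^N`).  Space dimension: the paper's `d` ↤ `d + 1` (sites `Fin (d+1) → ℤ`).  Scale `k ≥ 1`: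
mesh `η = L^{-k}` ↤ `n = L^k`; `a_k` ↤ `B1.aSeq a L k`; `s` ↤ `Lᵏε` (any real in `(0, 1]`: `Lᵏε ≦ Lᴷε ≦ ε₀ ≦ 1`,
stopping rule p. 582); `Λ_k` ↤ a `Finset (Fin (d+1) → ℤ)`; `Bᵏ(Λ_k)` ↤ `B4Lower18.fineDom (L^k) Λ_k`;
`⟨φ′_k, Δ⁽ᵏ⁾(Bᵏ(Λ_k), 0)φ′_k⟩` (the unit-lattice operator of I (2.21) with Neumann conditions on `Bᵏ(Λ_k)` and mass
`m²(Lᵏε)²`, cf. `B2.rescale_mass`) ↤ `Σ_c φ′_c ⬝ᵥ KeffR (L^k) a_k (m²s²) Λ_k *ᵥ φ′_c` (`formZ`); `Σ_{⟨x,x′⟩⊂Λ_k}|φ′(x′) −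
φ′(x)|²` (each positively oriented bond once) ↤ `Σ_c dirS Λ_k (extS Λ_k φ′_c)` (`bondZ`); `Σ_{x∈Λ_k}|φ′(x)|²` ↤ `Σ_c φ′_c
⬝ᵥ φ′_c` (`sqZ`); the rescaling sentence `φ′_k := (Lᵏε)^{(d−2)/2}·φ_k(Lᵏε ·)` ↤ `rescale s φ` (same index set), under
which the kᵗʰ bond / mass sums of (3.26) ARE the sums of (3.29) (`bondZ_rescale`, `massTerm_rescale`; scalar identities
`B2.rescale_bond` / `B2.rescale_mass` of the cell).

WHAT IS PROVED (kernel, no `sorry`, axioms standard; definitions = carriers with bodies).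
§1 `gamma0` (the constant) with `gamma0_pos`; **`formZ_ge`** = (3.29) AT `Ã^η = 0` WITH THE
k-UNIFORM CONSTANT: `γ₀·(bondZ φ′ + m²s²·sqZ φ′) ≦ formZ (L^k) a_k (m²s²) Λ_k φ′` for all `k ≥ 1`, `0 < s ≦ 1`, `Λ_k`, `φ′`
(from `B4Prop31Zero.KeffR_form_ge` at mesh `L^k`, `a_k > a_∞` (`B1.ainf_lt_aSeq`), `m²s² ≦ m²`).
§2 the ZERO-FIELD FAMILY of (3.29)-instances `zero329Fam` (index `ZIdx329`: `k ≥ 1`, `s ∈ (0,1]`, `Λ_k`, `N`, `φ′_k`;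
`restricted := True` — no restriction is used) and **`ineq329Printed_zeroField`**: `B2.Ineq329Printed κ₀ (zero329Fam d L a m²)`
for EVERY `κ₀`, with `γ₀ = gamma0`, `C = 0`; `ineq329Upto_zeroField` (the threshold form, any `eEff`, `e₁ = 1`).
§3 the ZERO-FIELD MULTISCALE FAMILY `ZMulti` / `zeroP31Fam P` of (3.26)-instances: data `ε > 0`, `K` with `Lᴷε ≦ 1`,
regions `Λ_k` and physical configurations `φ_k : Λ_k → ℝ^N` (k = 1 … K), the k = 0 sums `bond0, mass0 ≧ 0` (the k = 0
term of (3.28) IS `bond0 + mass0` at `U ≡ 1`: *"already has the form required"*), and the two reals `form` = ⟨Φ,Δ(0)Φ⟩,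
`formN` = ⟨Φ,Δ′(0)Φ⟩ WITH (3.27) `formN ≦ form` and (3.28) `formN = Σ_k term_k` AS FIELDS (the Gaussian integral (3.23)
defining Δ, Δ′ is NOT constructed here — (3.27) is p15's `B2Sect3BSchurStep.ineq327` in matrix coordinates);
**`sum326_le_form`** (= (3.26)₀: `γ₀(Σ_{k=0}^{K} bond_k) + γ₀(Σ_{k=0}^{K} mass_k) ≦ form`, the bond/mass sums the PRINTED
ones in the physical fields `φ_k` with the weights `(Lᵏε)^{d−2}`, `(Lᵏε)^d m²`) via `B2.prop31_of_decoupling` with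
(3.29)₀ = `formZ_ge` discharging its `h329` and the rescaling lemmas; **`prop31Printed_zeroField`**:
`B2.Prop31Printed P (zeroP31Fam P d m²)` (both conjuncts; the error constant `C = 0`).
HONEST SCOPE.  (i) `Ã = 0` ONLY — nothing of Proposition 3.1 for `Ã ≠ 0` (the restricted clause with the
`O((Lᵏε)^{κ₀})` error, whose input (3.29) at `Ã ≠ 0` is B4's Prop. 3.1′ on regular fields, `B4Prop31Regular`, under the
exponent bookkeeping of cell GAPS G-pv07-1) is asserted.  (ii) `γ₀` depends on `d`, `a`, `L` (through `a_∞ = a(1 − L⁻²) ≧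
3a/4`) and on the bound `m²` for `m²(Lᵏε)²` — the print's *"dependent on … d and the constant a only"* plus its *"We assume
m² ≦ O(1) also"*; no sharp constant is attempted (`B4Prop31Zero` HONEST SCOPE).  (iii) In §3 the multiscale geometry
(the sets Λ₅⁽ʲ⁾, the primes, (3.24)) is not constructed: an instance is GIVEN by its annuli `Λ_k`, fields and the two
forms with (3.27)/(3.28); the kernel content is (3.29)₀ at every scale with one constant + the printed bookkeeping.
Value = kernel certificate of a published inequality in a special case + two typed cell Props inhabited on concrete
zero-field carriers; NOT summit progress.
-/

noncomputable section

namespace Literature.MathematicalPhysics.QuantumFieldTheory.Balaban1983to89.B2Prop31ZeroField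

open Finset Matrix
open Literature.MathematicalPhysics.QuantumFieldTheory.Balaban1983to89
open Literature.MathematicalPhysics.QuantumFieldTheory.Balaban1983to89.B4Prop31Zero

variable {d : ℕ}

/-! ## §1  The constant and (3.29) at `Ã^η = 0`, uniformly in the scale -/

/-- **THE CONSTANT** `γ₀ = min(a_∞/(8(d+1) + 2m²), 1/8)`, `a_∞ = a(1 − L⁻²)` (I (2.15)): `B4Prop31Zero`'s
`min(a_k/(8(d+1) + 2m²(Lᵏε)²), 1/8)` made independent of `k` and of `Lᵏε ≦ 1` through `a_k > a_∞`, `m²(Lᵏε)² ≦ m²`.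
[cite: Balaban1982Higgs2, Prop. 3.1 p.589 «a constant γ₀ > 0 dependent on the space dimension d and the constant a only»] -/
def gamma0 (d : ℕ) (L a m2 : ℝ) : ℝ := min (a * (1 - (L ^ 2)⁻¹) / (8 * (d + 1) + 2 * m2)) (1 / 8)

/-- `γ₀ > 0` for `a > 0`, `L > 1`, `m² ≧ 0` (*"There exists a constant γ₀ > 0 …"*).
[cite: Balaban1982Higgs2, Prop. 3.1 p.589] -/
theorem gamma0_pos (d : ℕ) {L a m2 : ℝ} (hL : 1 < L) (ha : 0 < a) (hm : 0 ≤ m2) : 0 < gamma0 d L a m2 := by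
  unfold gamma0
  have hL2 : (1 : ℝ) < L ^ 2 := by nlinarith
  have hinv : (L ^ 2)⁻¹ < 1 := inv_lt_one_of_one_lt₀ hL2
  have h1 : 0 < a * (1 - (L ^ 2)⁻¹) := mul_pos ha (by linarith)
  exact lt_min (by positivity) (by norm_num)

/-- `γ₀ ≦ 1`. [folklore] -/
private theorem gamma0_le_one (d : ℕ) (L a m2 : ℝ) : gamma0 d L a m2 ≤ 1 :=
  (min_le_right _ _).trans (by norm_num)

/-- `⟨φ′, Δ⁽ᵏ⁾(Bᵏ(Λ_k), 0)φ′⟩` for an `ℝ^N`-valued `φ′` on the unit lattice `Λ_k`: the `B4Prop31Zero.KeffR n a_k μ Λ_k`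
form summed over components (`μ` ↤ `m²(Lᵏε)²`, `n` ↤ `L^k`). [cite: Balaban1982Higgs2, (3.29) p.590, dictionary] -/
def formZ (n : ℕ) (ak μ : ℝ) (Λ : Finset (Fin (d + 1) → ℤ)) {N : ℕ} (φ : ↥Λ → Fin N → ℝ) : ℝ :=
  ∑ c : Fin N, (fun y => φ y c) ⬝ᵥ (KeffR n ak μ Λ).mulVec (fun y => φ y c)

/-- `Σ_{⟨x,x′⟩⊂Λ_k}|φ′(x′) − φ′(x)|²` at `U ≡ 1` (each positively oriented nearest-neighbour bond with both endpoints in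
`Λ_k` once; `B4Prop31Zero.dirS` summed over components). [cite: Balaban1982Higgs2, (3.29) p.590, dictionary] -/
def bondZ (Λ : Finset (Fin (d + 1) → ℤ)) {N : ℕ} (φ : ↥Λ → Fin N → ℝ) : ℝ :=
  ∑ c : Fin N, dirS Λ (extS Λ (fun y => φ y c))

/-- `Σ_{x∈Λ_k}|φ′(x)|²`. [cite: Balaban1982Higgs2, (3.29) p.590, dictionary] -/
def sqZ (Λ : Finset (Fin (d + 1) → ℤ)) {N : ℕ} (φ : ↥Λ → Fin N → ℝ) : ℝ :=
  ∑ c : Fin N, (fun y => φ y c) ⬝ᵥ (fun y => φ y c)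

/-- **(3.29) AT `Ã^η = 0`, k-UNIFORM CONSTANT, NO ERROR TERM, NO RESTRICTION**: for every `L > 1`, `a > 0`, `m² ≧ 0`,
every scale `k ≧ 1` (mesh `L^{-k}`, `a_k = B1.aSeq a L k`), every `s = Lᵏε ∈ (0, 1]`, every finite `Λ_k ⊂ ℤ^{d+1}` and every
`φ′ : Λ_k → ℝ^N`:  `γ₀·(Σ_{⟨x,x′⟩⊂Λ_k}|φ′(x′) − φ′(x)|² + Σ_{x∈Λ_k} m²(Lᵏε)²|φ′(x)|²) ≦ ⟨φ′, Δ⁽ᵏ⁾(Bᵏ(Λ_k), 0)φ′⟩` with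
`γ₀ = gamma0 d L a m²` — from `B4Prop31Zero.KeffR_form_ge` (B4 p. 574 *"This theorem implies (3.29) of [2]"*, at
`A = 0`), `a_∞ < a_k` (`B1.ainf_lt_aSeq`) and `m²s² ≦ m²`.
[cite: Balaban1982Higgs2, (3.29) p.590, case Ã^η = 0 (constant and proof the package's)] -/
theorem formZ_ge {L : ℕ} (hL : 1 < L) {a m2 : ℝ} (ha : 0 < a) (hm : 0 ≤ m2) {k : ℕ} (hk : 1 ≤ k)
    {s : ℝ} (hs : 0 < s) (hs1 : s ≤ 1) (Λ : Finset (Fin (d + 1) → ℤ)) {N : ℕ} (φ : ↥Λ → Fin N → ℝ) :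
    gamma0 d L a m2 * (bondZ Λ φ + m2 * s ^ 2 * sqZ Λ φ)
      ≤ formZ (L ^ k) (B1.aSeq a L k) (m2 * s ^ 2) Λ φ := by
  have hn : 1 ≤ L ^ k := Nat.one_le_pow _ _ (by omega)
  have hLr : (1 : ℝ) < (L : ℝ) := by exact_mod_cast hL
  have hak : a * (1 - ((L : ℝ) ^ 2)⁻¹) < B1.aSeq a L k := B1.ainf_lt_aSeq ha hLr k hk
  have hak0 : 0 < B1.aSeq a L k := B1.aSeq_pos ha hLr hk
  have hL2 : (1 : ℝ) < (L : ℝ) ^ 2 := by nlinarith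
  have hinv : ((L : ℝ) ^ 2)⁻¹ < 1 := inv_lt_one_of_one_lt₀ hL2
  have hainf : 0 ≤ a * (1 - ((L : ℝ) ^ 2)⁻¹) := mul_nonneg ha.le (by linarith)
  have hs2 : s ^ 2 ≤ 1 := by nlinarith
  have hμ : 0 ≤ m2 * s ^ 2 := by positivity
  have hμB : m2 * s ^ 2 ≤ m2 := by nlinarith
  have hle : gamma0 d L a m2 ≤ min (B1.aSeq a L k / (8 * (d + 1) + 2 * (m2 * s ^ 2))) (1 / 8) := by
    unfold gamma0
    refine min_le_min ?_ le_rfl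
    have hd1 : (0 : ℝ) < 8 * (d + 1) + 2 * (m2 * s ^ 2) := by positivity
    calc a * (1 - ((L : ℝ) ^ 2)⁻¹) / (8 * (d + 1) + 2 * m2)
        ≤ a * (1 - ((L : ℝ) ^ 2)⁻¹) / (8 * (d + 1) + 2 * (m2 * s ^ 2)) :=
          div_le_div_of_nonneg_left hainf hd1 (by linarith)
      _ ≤ B1.aSeq a L k / (8 * (d + 1) + 2 * (m2 * s ^ 2)) := div_le_div_of_nonneg_right hak.le hd1.le
  have hc : ∀ c : Fin N,
      gamma0 d L a m2 * (dirS Λ (extS Λ (fun y => φ y c)) + m2 * s ^ 2 * ((fun y => φ y c) ⬝ᵥ (fun y => φ y c)))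
        ≤ (fun y => φ y c) ⬝ᵥ (KeffR (L ^ k) (B1.aSeq a L k) (m2 * s ^ 2) Λ).mulVec (fun y => φ y c) := by
    intro c
    have h := KeffR_form_ge hn hak0 hμ Λ (fun y => φ y c)
    have hX : 0 ≤ dirS Λ (extS Λ (fun y => φ y c)) + m2 * s ^ 2 * ((fun y => φ y c) ⬝ᵥ (fun y => φ y c)) :=
      add_nonneg (dirS_nonneg _ _) (mul_nonneg hμ (Finset.sum_nonneg fun y _ => mul_self_nonneg (φ y c)))
    exact (mul_le_mul_of_nonneg_right hle hX).trans h
  have hsplit : gamma0 d L a m2 * (bondZ Λ φ + m2 * s ^ 2 * sqZ Λ φ)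
      = ∑ c : Fin N, gamma0 d L a m2 *
          (dirS Λ (extS Λ (fun y => φ y c)) + m2 * s ^ 2 * ((fun y => φ y c) ⬝ᵥ (fun y => φ y c))) := by
    simp only [bondZ, sqZ, Finset.mul_sum, mul_add, Finset.sum_add_distrib]
  rw [hsplit]
  exact Finset.sum_le_sum fun c _ => hc c

/-! ## §2  The zero-field family of (3.29)-instances: `B2.Ineq329Printed` inhabited -/

/-- **INDEX OF THE ZERO-FIELD INSTANCES OF (3.29)** (model constants `d, L, a, m²` fixed outside): a scale `k ≧ 1`, the
real `s = Lᵏε` with `0 < s ≦ 1`, the unit-lattice region `Λ_k` (finite, `⊂ ℤ^{d+1}`), the number `N` of real components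
and the configuration `φ′_k : Λ_k → ℝ^N` (`Ã^η = 0`). [cite: Balaban1982Higgs2, (3.29) p.590, dictionary] -/
structure ZIdx329 (d L : ℕ) (a m2 : ℝ) where
  -- the scale `k ≧ 1`
  k : ℕ
  hk : 1 ≤ k
  -- `s = Lᵏε`
  s : ℝ
  hs : 0 < s
  hs1 : s ≤ 1
  -- the unit-lattice region `Λ_k`
  Λ : Finset (Fin (d + 1) → ℤ)
  -- number of real field components
  N : ℕ
  -- the configuration `φ′_k`
  φ : ↥Λ → Fin N → ℝ

/-- **THE ZERO-FIELD CARRIERS OF `B2.I329Setting`**: `s = Lᵏε`, `massSq = m²`, `restricted := True` (the zero-field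
clause needs no restriction, so every instance counts as restricted — the strongest reading), `form = ⟨φ′_k,
Δ⁽ᵏ⁾(Bᵏ(Λ_k), 0)φ′_k⟩` (`formZ` at mesh `L^k`, `a_k = B1.aSeq a L k`, mass `m²s²`), `covDiffSq = Σ_{⟨x,x′⟩⊂Λ_k}|φ′(x′) −
φ′(x)|²` (`bondZ`), `l2sq = Σ_{x∈Λ_k}|φ′(x)|²` (`sqZ`), `vol = |Λ_k|`.
[cite: Balaban1982Higgs2, (3.29) p.590, dictionary at Ã^η = 0] -/
def zero329Fam (d L : ℕ) (a m2 : ℝ) (i : ZIdx329 d L a m2) : B2.I329Setting where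
  s := i.s
  massSq := m2
  restricted := True
  form := formZ (L ^ i.k) (B1.aSeq a L i.k) (m2 * i.s ^ 2) i.Λ i.φ
  covDiffSq := bondZ i.Λ i.φ
  l2sq := sqZ i.Λ i.φ
  vol := i.Λ.card

/-- **THE CELL'S TYPED (3.29) `B2.Ineq329Printed` HOLDS ON THE ZERO-FIELD FAMILY**, for every exponent `κ₀`, with
`γ₀ = gamma0 d L a m²` (*"independent of k, Λ_k"*) and error constant `C = 0` (no `O((Lᵏε)^{κ₀})|Λ_k|` term at `Ã^η = 0`).
[cite: Balaban1982Higgs2, (3.29) p.590, case Ã^η = 0 (constant and proof the package's)] -/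
theorem ineq329Printed_zeroField (κ₀ : ℝ) {L : ℕ} (hL : 1 < L) {a m2 : ℝ} (ha : 0 < a) (hm : 0 ≤ m2) :
    B2.Ineq329Printed κ₀ (zero329Fam d L a m2) := by
  refine ⟨gamma0 d L a m2, 0, gamma0_pos d (by exact_mod_cast hL) ha hm, le_rfl, fun i _ => ?_⟩
  simp only [zero329Fam, zero_mul, sub_zero]
  exact formZ_ge hL ha hm i.hk i.hs i.hs1 i.Λ i.φ

/-- The threshold form `B2.Ineq329Upto` (the shape in which B4 delivers (3.29)) on the zero-field family, for any
assignment `eEff` of effective couplings and threshold `e₁ = 1` (nothing depends on them at `Ã^η = 0`).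
[cite: Balaban1982Higgs2, (3.29) p.590, case Ã^η = 0] -/
theorem ineq329Upto_zeroField (κ₀ : ℝ) {L : ℕ} (hL : 1 < L) {a m2 : ℝ} (ha : 0 < a) (hm : 0 ≤ m2)
    (eEff : ZIdx329 d L a m2 → ℝ) : B2.Ineq329Upto κ₀ (zero329Fam d L a m2) eEff := by
  obtain ⟨γ₀, C, hγ, hC, h⟩ := ineq329Printed_zeroField (d := d) κ₀ hL ha hm
  exact ⟨1, one_pos, γ₀, C, hγ, hC, fun i hr _ => h i hr⟩

/-! ## §3  The zero-field clause of Proposition 3.1: (3.26)₀ by (3.27)–(3.28) and (3.29)₀ -/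

/-- The rescaling sentence p. 590 *"φ_k(x) = (Lᵏε)^{−(d−2)/2}φ′_k((Lᵏε)⁻¹x)"* read as the definition of the unit-lattice
configuration from the physical one on the same index set: `φ′_k = (Lᵏε)^{(d−2)/2}·φ_k` (paper's `d` = our `d + 1`).
[cite: Balaban1982Higgs2, p.590 «Let us rescale the kᵗʰ term from the Lᵏε-lattice to the 1-lattice»] -/
def rescale (s : ℝ) {Λ : Finset (Fin (d + 1) → ℤ)} {N : ℕ} (φ : ↥Λ → Fin N → ℝ) : ↥Λ → Fin N → ℝ :=
  fun y c => s ^ ((((d + 1 : ℕ) : ℝ) - 2) / 2) * φ y c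

/-- the square of the rescaling factor: `((Lᵏε)^{(d−2)/2})² = (Lᵏε)^{d−2}`. [folklore] -/
private theorem rescaleFactor_sq {s : ℝ} (hs : 0 < s) :
    (s ^ ((((d + 1 : ℕ) : ℝ) - 2) / 2)) ^ 2 = s ^ (((d + 1 : ℕ) : ℝ) - 2) := by
  rw [← Real.rpow_natCast (s ^ ((((d + 1 : ℕ) : ℝ) - 2) / 2)) 2, ← Real.rpow_mul hs.le]
  congr 1
  push_cast
  ring

/-- **the kᵗʰ BOND SUM of (3.26) is the bond sum of (3.29)**: `Σ_{⟨x,x′⟩⊂Λ_k}(Lᵏε)^{d−2}|φ_k(x′) − φ_k(x)|² =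
Σ_{⟨x,x′⟩⊂Λ_k}|φ′_k(x′) − φ′_k(x)|²` (the cell's scalar identity `B2.rescale_bond`, summed).
[cite: Balaban1982Higgs2, (3.26)/(3.29) pp.589–590, rescaling] -/
theorem bondZ_rescale {s : ℝ} (hs : 0 < s) {Λ : Finset (Fin (d + 1) → ℤ)} {N : ℕ} (φ : ↥Λ → Fin N → ℝ) :
    bondZ Λ (rescale s φ) = s ^ (((d + 1 : ℕ) : ℝ) - 2) * bondZ Λ φ := by
  unfold bondZ
  rw [Finset.mul_sum]
  refine Finset.sum_congr rfl fun c _ => ?_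
  have hfun : (fun y => rescale s φ y c) = (s ^ ((((d + 1 : ℕ) : ℝ) - 2) / 2)) • (fun y => φ y c) := by
    funext y; simp [rescale]
  rw [hfun, extS_smul, dirS_smul, rescaleFactor_sq hs]

/-- `Σ_x|φ′_k(x)|² = (Lᵏε)^{d−2}Σ_x|φ_k(x)|²`. [folklore] -/
private theorem sqZ_rescale {s : ℝ} (hs : 0 < s) {Λ : Finset (Fin (d + 1) → ℤ)} {N : ℕ} (φ : ↥Λ → Fin N → ℝ) :
    sqZ Λ (rescale s φ) = s ^ (((d + 1 : ℕ) : ℝ) - 2) * sqZ Λ φ := by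
  unfold sqZ
  rw [Finset.mul_sum]
  refine Finset.sum_congr rfl fun c _ => ?_
  have hfun : (fun y => rescale s φ y c) = (s ^ ((((d + 1 : ℕ) : ℝ) - 2) / 2)) • (fun y => φ y c) := by
    funext y; simp [rescale]
  rw [hfun, smul_dotProduct, dotProduct_smul, smul_eq_mul, smul_eq_mul, ← mul_assoc, ← sq, rescaleFactor_sq hs]

/-- **the kᵗʰ MASS SUM of (3.26) is the mass sum of (3.29)**: `Σ_{x∈Λ_k}(Lᵏε)^d m²|φ_k(x)|² = Σ_{x∈Λ_k} m²(Lᵏε)²|φ′_k(x)|²`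
(the cell's `B2.rescale_mass`, summed). [cite: Balaban1982Higgs2, (3.26)/(3.29) pp.589–590, rescaling] -/
theorem massTerm_rescale {s : ℝ} (hs : 0 < s) (m2 : ℝ) {Λ : Finset (Fin (d + 1) → ℤ)} {N : ℕ}
    (φ : ↥Λ → Fin N → ℝ) :
    m2 * s ^ 2 * sqZ Λ (rescale s φ) = s ^ (d + 1) * (m2 * sqZ Λ φ) := by
  rw [sqZ_rescale hs]
  have hpow : s ^ 2 * s ^ (((d + 1 : ℕ) : ℝ) - 2) = s ^ (d + 1) := by
    rw [← Real.rpow_natCast s 2, ← Real.rpow_add hs, ← Real.rpow_natCast s (d + 1)]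
    congr 1
    push_cast
    ring
  calc m2 * s ^ 2 * (s ^ (((d + 1 : ℕ) : ℝ) - 2) * sqZ Λ φ)
      = (s ^ 2 * s ^ (((d + 1 : ℕ) : ℝ) - 2)) * (m2 * sqZ Λ φ) := by ring
    _ = s ^ (d + 1) * (m2 * sqZ Λ φ) := by rw [hpow]

/-- **INDEX OF THE ZERO-FIELD MULTISCALE INSTANCES OF (3.26)** (model constants `d, L, a, m²` fixed outside): the lattice
spacing `ε > 0` and the number of steps `K` with `Lᴷε ≦ 1` (p. 582: `Lᴷε ≦ ε₀`); for `k = 1, …, K` the unit-lattice annuli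
`Λ_k = (Λ₅⁽ᵏ⁻¹⁾′∩Λ₅⁽ᵏ⁾ᶜ)₁` (any finite sets) and the PHYSICAL configurations `φ_k` on them (`N` real components); the
k = 0 sums `bond0 = Σ_{⟨x,x′⟩⊂Λ₅⁽⁰⁾ᶜ}ε^{d−2}|φ₀(x′) − φ₀(x)|² ≧ 0`, `mass0 = Σ_{x∈Λ₅⁽⁰⁾ᶜ}ε^d m²|φ₀(x)|² ≧ 0` (at `U ≡ 1`
the k = 0 term of (3.28), `⟨φ₀, (−Δ^{ε,N}_{Λ₅⁽⁰⁾ᶜ} + m²)φ₀⟩`, IS `bond0 + mass0` — *"The term for k = 0 already has the form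
required"*); and the two printed forms `form = ⟨Φ, Δ(0)Φ⟩`, `formN = ⟨Φ, Δ′(0)Φ⟩` of (3.25)/(3.27) GIVEN WITH (3.27)
`formN ≦ form` (`h327`; proved for the Gaussian integral in matrix coordinates by `B2Sect3BSchurStep.ineq327`) and
(3.28) `formN = Σ_{k=0}^{K} ⟨φ_k, Δ^{(k),Lᵏε}(Bᵏ(Λ_k), 0)φ_k⟩` (`h328`, the kᵗʰ term written on the 1-lattice through
`rescale`, cf. I (1.22)). The multiscale Gaussian integral (3.23) itself is not constructed in this file.
[cite: Balaban1982Higgs2, Prop. 3.1 (3.26)–(3.28) pp.589–590, dictionary at Ã^ε = 0] -/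
structure ZMulti (d L : ℕ) (a m2 : ℝ) where
  -- lattice spacing
  ε : ℝ
  hε : 0 < ε
  -- number of renormalization steps
  K : ℕ
  -- `Lᴷε ≦ 1`
  hK : (L : ℝ) ^ K * ε ≤ 1
  -- the annuli `Λ_k`, k = 1 … K (values at other `k` unused)
  Λ : ℕ → Finset (Fin (d + 1) → ℤ)
  -- number of real field components
  N : ℕ
  -- the physical configurations `φ_k` on `Λ_k`
  φ : (k : ℕ) → ↥(Λ k) → Fin N → ℝ
  -- the k = 0 bond sum
  bond0 : ℝ
  -- the k = 0 mass sum
  mass0 : ℝ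
  hb0 : 0 ≤ bond0
  hm0 : 0 ≤ mass0
  -- `⟨Φ, Δ(0)Φ⟩`
  form : ℝ
  -- `⟨Φ, Δ′(0)Φ⟩`
  formN : ℝ
  -- (3.27)
  h327 : formN ≤ form
  -- (3.28), the terms k ≧ 1 on the 1-lattice
  h328 : formN = bond0 + mass0 + ∑ k ∈ Icc 1 K,
    formZ (L ^ k) (B1.aSeq a L k) (m2 * ((L : ℝ) ^ k * ε) ^ 2) (Λ k) (rescale ((L : ℝ) ^ k * ε) (φ k))

namespace ZMulti

variable {L : ℕ} {a m2 : ℝ}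

/-- `s_k = Lᵏε`. [cite: Balaban1982Higgs2, (3.26) p.589, dictionary] -/
def s (i : ZMulti d L a m2) (k : ℕ) : ℝ := (L : ℝ) ^ k * i.ε

/-- the kᵗʰ term of (3.28): `bond0 + mass0` at k = 0, `⟨φ_k, Δ^{(k),Lᵏε}(Bᵏ(Λ_k),0)φ_k⟩ = ⟨φ′_k, Δ⁽ᵏ⁾(Bᵏ(Λ_k),0)φ′_k⟩`
(1-lattice form of the rescaled field) for k ≧ 1. [cite: Balaban1982Higgs2, (3.28) p.589, dictionary at Ã^ε = 0] -/
def term (i : ZMulti d L a m2) (k : ℕ) : ℝ :=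
  if k = 0 then i.bond0 + i.mass0
  else formZ (L ^ k) (B1.aSeq a L k) (m2 * i.s k ^ 2) (i.Λ k) (rescale (i.s k) (i.φ k))

/-- the kᵗʰ bond sum of (3.26) at `U ≡ 1`: `Σ_{⟨x,x′⟩⊂Λ_k}(Lᵏε)^{d−2}|φ_k(x′) − φ_k(x)|²` (k ≧ 1), `bond0` (k = 0).
[cite: Balaban1982Higgs2, (3.26) p.589, dictionary at Ã^ε = 0] -/
def bond (i : ZMulti d L a m2) (k : ℕ) : ℝ :=
  if k = 0 then i.bond0 else i.s k ^ (((d + 1 : ℕ) : ℝ) - 2) * bondZ (i.Λ k) (i.φ k)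

/-- the kᵗʰ mass sum of (3.26): `Σ_{x∈Λ_k}(Lᵏε)^d m²|φ_k(x)|²` (k ≧ 1), `mass0` (k = 0).
[cite: Balaban1982Higgs2, (3.26) p.589, dictionary at Ã^ε = 0] -/
def mass (i : ZMulti d L a m2) (k : ℕ) : ℝ :=
  if k = 0 then i.mass0 else i.s k ^ (d + 1) * (m2 * sqZ (i.Λ k) (i.φ k))

/-- `0 < s_k`. [folklore] -/
private theorem s_pos (i : ZMulti d L a m2) (hL : 1 < L) (k : ℕ) : 0 < i.s k := by
  unfold s
  have : (0 : ℝ) < (L : ℝ) := by exact_mod_cast (by omega : 0 < L)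
  exact mul_pos (pow_pos this k) i.hε

/-- `s_k ≦ 1` for `k ≦ K` (from `Lᴷε ≦ 1`, `L ≧ 1`). [folklore] -/
private theorem s_le_one (i : ZMulti d L a m2) (hL : 1 < L) {k : ℕ} (hk : k ≤ i.K) : i.s k ≤ 1 := by
  unfold s
  have hL1 : (1 : ℝ) ≤ (L : ℝ) := by exact_mod_cast hL.le
  exact (mul_le_mul_of_nonneg_right (pow_le_pow_right₀ hL1 hk) i.hε.le).trans i.hK

/-- (3.28) in the `range (K+1)` shape of `B2.prop31_of_decoupling`. [cite: Balaban1982Higgs2, (3.28) p.589] -/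
theorem formN_eq_sum_term (i : ZMulti d L a m2) : i.formN = ∑ k ∈ range (i.K + 1), i.term k := by
  rw [sum_range_eq_add_Ico _ (by omega : 0 < i.K + 1), Finset.Ico_add_one_right_eq_Icc, i.h328]
  have h0 : i.term 0 = i.bond0 + i.mass0 := by simp [term]
  rw [h0]
  congr 1
  refine Finset.sum_congr rfl fun k hk => ?_
  have hk1 : k ≠ 0 := by have := (mem_Icc.mp hk).1; omega
  simp [term, hk1, s]

/-- **(3.26) AT `Ã^ε = 0`** — *"the inequality holds without the last sum on the right side and without any restrictions
on the configuration Φ"*: for every zero-field multiscale instance,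
`γ₀(Σ_{k=0}^{K} bond_k) + γ₀(Σ_{k=0}^{K} mass_k) ≦ ⟨Φ, Δ(0)Φ⟩` with `γ₀ = gamma0 d L a m²` (independent of ε, K, the
annuli and the fields), by the printed reduction: (3.27) and (3.28) (the instance's data) and, for k = 1 … K, (3.29)₀
(`formZ_ge`) after the rescaling (`bondZ_rescale`, `massTerm_rescale`) — the cell's bookkeeping `B2.prop31_of_decoupling`
with its hypothesis `h329` DISCHARGED and zero error terms.
[cite: Balaban1982Higgs2, Prop. 3.1 (3.26) p.589, case Ã^ε = 0 (constant and proof the package's)] -/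
theorem sum326_le_form (i : ZMulti d L a m2) (hL : 1 < L) (ha : 0 < a) (hm : 0 ≤ m2) :
    gamma0 d L a m2 * (∑ k ∈ range (i.K + 1), i.bond k) + gamma0 d L a m2 * (∑ k ∈ range (i.K + 1), i.mass k)
      ≤ i.form := by
  have hγ1 := gamma0_le_one d (L : ℝ) a m2
  have hγ0 := (gamma0_pos d (by exact_mod_cast hL : (1 : ℝ) < (L : ℝ)) ha hm).le
  have h0 : gamma0 d L a m2 * i.bond 0 + gamma0 d L a m2 * i.mass 0 ≤ i.term 0 := by
    simp only [bond, mass, term, if_true]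
    have h1 : gamma0 d L a m2 * i.bond0 ≤ i.bond0 := mul_le_of_le_one_left i.hb0 hγ1
    have h2 : gamma0 d L a m2 * i.mass0 ≤ i.mass0 := mul_le_of_le_one_left i.hm0 hγ1
    linarith
  have h329 : ∀ k, 1 ≤ k → k ≤ i.K →
      gamma0 d L a m2 * (i.bond k + i.mass k) - 0 ≤ i.term k := by
    intro k hk1 hkK
    have hk0 : k ≠ 0 := by omega
    simp only [bond, mass, term, hk0, if_false, sub_zero]
    have hs := i.s_pos hL k
    rw [← bondZ_rescale hs, ← massTerm_rescale hs]
    exact formZ_ge hL ha hm hk1 hs (i.s_le_one hL hkK) (i.Λ k) (rescale (i.s k) (i.φ k))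
  have h := B2.prop31_of_decoupling i.K (gamma0 d L a m2) i.form i.formN i.term i.bond i.mass (fun _ => 0)
    i.h327 i.formN_eq_sum_term h0 h329
  simpa using h

end ZMulti

/-- **THE ZERO-FIELD CARRIERS OF `B2.P31Setting`** for `B2.Prop31Printed P`: from a multiscale instance with the model
constants `L := P.L`, `a := P.a`: `ε`, `K`, `restricted := True` and `zeroField := True` (every instance is a zero-field
instance; counting it also as «restricted» is the strongest reading and costs nothing, the error constant being `0`),
`form`, `formN`, `term`, `bond`, `mass` as in `ZMulti`, `vol k = |Λ_k|`.
[cite: Balaban1982Higgs2, Prop. 3.1 (3.26)–(3.28) p.589, dictionary at Ã^ε = 0] -/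
def zeroP31Fam (P : B2.Params) (d : ℕ) (m2 : ℝ) (i : ZMulti d P.L P.a m2) : B2.P31Setting where
  ε := i.ε
  K := i.K
  restricted := True
  zeroField := True
  form := i.form
  formN := i.formN
  term := i.term
  bond := i.bond
  mass := i.mass
  vol := fun k => (i.Λ k).card

/-- **THE CELL'S TYPED PROPOSITION 3.1 `B2.Prop31Printed P` HOLDS ON THE ZERO-FIELD MULTISCALE FAMILY** (both conjuncts:
the «restricted» one with error constant `C = 0` and the printed zero-field one), with `γ₀ = gamma0 d P.L P.a m²`, for
every parameter record `P` with `P.L > 1`, `P.a > 0` and every `m² ≧ 0`, `d`.  Nothing is claimed for `Ã^ε ≠ 0`.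
[cite: Balaban1982Higgs2, Prop. 3.1 (3.26) p.589, case Ã^ε = 0 (constant and proof the package's)] -/
theorem prop31Printed_zeroField (P : B2.Params) (hL : 1 < P.L) (ha : 0 < P.a) (d : ℕ) {m2 : ℝ} (hm : 0 ≤ m2) :
    B2.Prop31Printed P (zeroP31Fam P d m2) := by
  refine ⟨gamma0 d P.L P.a m2, 0, gamma0_pos d (by exact_mod_cast hL) ha hm, le_rfl, fun i _ => ?_, fun i _ => ?_⟩
  · simp only [zeroP31Fam, zero_mul, Finset.sum_const_zero, sub_zero]
    exact i.sum326_le_form hL ha hm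
  · exact i.sum326_le_form hL ha hm

end Literature.MathematicalPhysics.QuantumFieldTheory.Balaban1983to89.B2Prop31ZeroField

end
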